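import Summits.CriticalPhenomena.PercolationContinuityZ3.Theorems.PercNearOneGluingNoHeavyLowerTailSahiCombTriWQZetaRank

/-!
# The q-SUPPORT LEMMA (on an up-set and on a translate): completing the q-zeta toolkit for the CERT-GEN(q) elimination

Support file of the one-cut programme (crux `NoHeavyLowerTail`, stmt-CriticalPhenomena-4575; cell `prim-masterthm`, seat P5 gen 19;
memo `FROM-prim-masterthm-p5-g19-QZETA-CHANNELS.md` §1/§8).  Companion of `…TriWQZetaRank` (q-C1, q-TR).  For `q ≠ 0`, an up-set `W` and ANY `d`,
the restricted q-zeta function `t ↦ ζ_q(d,t) = [d ⊆ t]·q^{#(t \ d)}` on `W` (resp. on the translate `transl s W`) is a `ℚ`-combination of the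
q-zeta functions of the `e ⊆ d` with `eᶜ ∈ W` (resp. additionally `d ∩ s ⊆ e`) — exactly as in the plain support lemma
`exists_support_coef` / `exists_support_coef_transl`, from which it follows by the rescaling `ζ_q(e,t) = q^{#t}/q^{#e}·[e ⊆ t]`:
the coefficient of `e` gets multiplied by `q^{#e}/q^{#d}`.  So in the q-antipodal basis `{ζ_q(e,·)|_W : eᶜ ∈ W}` (a basis by q-C1) the
coordinates of `ζ_q(d,·)|_W` are supported BELOW `d` — the confinement fact every RANK-Z-style elimination uses, now for every `q ≠ 0`.

* `exists_support_coef_qzeta` — on `W`;   * `exists_support_coef_qzeta_transl` — on `transl s W`.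
HONEST LABEL: elementary, proved (std axioms). [this work]
-/

namespace Summit.CriticalPhenomena.PercolationContinuityZ3.Theorems

namespace FiveUpSet

open Finset

variable {α : Type} [DecidableEq α] [Fintype α]

omit [Fintype α] in
/-- Rescaling a plain support expansion into a q-zeta one, termwise: for `q ≠ 0`,
`(c · q^{#e}/q^{#d}) · ζ_q(e,t) = (q^{#t}/q^{#d}) · (c · [e ⊆ t])`. [this work] -/
theorem rescale_term_qzeta {q : ℚ} (hq : q ≠ 0) (c : ℚ) (d e t : Finset α) :
    (c * (q ^ e.card / q ^ d.card)) * qzeta q e t = (q ^ t.card / q ^ d.card) * (c * (if e ⊆ t then (1 : ℚ) else 0)) := by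
  rw [qzeta_eq_div_mul_zeta hq]
  have he : q ^ e.card ≠ 0 := pow_ne_zero _ hq
  have hd : q ^ d.card ≠ 0 := pow_ne_zero _ hq
  field_simp

/-- **q-SUPPORT LEMMA (on an up-set).**  For an up-set `W`, `q ≠ 0` and any `d` there are coefficients `c e`, non-zero only for `e ⊆ d` with
`eᶜ ∈ W` (and `c = δ_d` when `dᶜ ∈ W`), such that `ζ_q(d,t) = Σ_e c e · ζ_q(e,t)` for every `t ∈ W`. [this work] -/
theorem exists_support_coef_qzeta {W : Finset (Finset α)} (hW : IsUpperSet (W : Set (Finset α))) {q : ℚ} (hq : q ≠ 0) (d : Finset α) :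
    ∃ c : Finset α → ℚ, (dᶜ ∈ W → c = fun e => if e = d then 1 else 0) ∧ (∀ e, c e ≠ 0 → eᶜ ∈ W ∧ e ⊆ d) ∧
      ∀ t ∈ W, qzeta q d t = ∑ e, c e * qzeta q e t := by
  obtain ⟨c, hcδ, hcsupp, hcid⟩ := exists_support_coef hW d
  refine ⟨fun e => c e * (q ^ e.card / q ^ d.card), ?_, ?_, ?_⟩
  · intro hd
    funext e
    rw [hcδ hd]
    by_cases hed : e = d
    · subst hed
      have : q ^ e.card ≠ 0 := pow_ne_zero _ hq
      simp [this]
    · simp [hed]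
  · intro e he
    have hce : c e ≠ 0 := by
      intro h0; apply he; simp only [h0, zero_mul]
    exact hcsupp e hce
  · intro t ht
    have hrw : ∀ e, c e * (q ^ e.card / q ^ d.card) * qzeta q e t
        = (q ^ t.card / q ^ d.card) * (c e * (if e ⊆ t then (1 : ℚ) else 0)) := fun e => rescale_term_qzeta hq (c e) d e t
    simp_rw [hrw]
    rw [← Finset.mul_sum, ← hcid t ht, qzeta_eq_div_mul_zeta hq]

/-- **q-SUPPORT LEMMA on a translate.**  For an up-set `W`, any `s`, `q ≠ 0` and any `d` there are coefficients `c e`, non-zero only for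
`e ⊆ d` with `eᶜ ∈ W` and `d ∩ s ⊆ e` (and `c = δ_d` when `dᶜ ∈ W`), such that `ζ_q(d,t) = Σ_e c e · ζ_q(e,t)` for every `t ∈ transl s W`.
[this work] -/
theorem exists_support_coef_qzeta_transl {W : Finset (Finset α)} (hW : IsUpperSet (W : Set (Finset α))) (s : Finset α)
    {q : ℚ} (hq : q ≠ 0) (d : Finset α) :
    ∃ c : Finset α → ℚ, (dᶜ ∈ W → c = fun e => if e = d then 1 else 0) ∧ (∀ e, c e ≠ 0 → eᶜ ∈ W ∧ e ⊆ d ∧ d ∩ s ⊆ e) ∧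
      ∀ t ∈ transl s W, qzeta q d t = ∑ e, c e * qzeta q e t := by
  obtain ⟨c, hcδ, hcsupp, hcid⟩ := exists_support_coef_transl hW s d
  refine ⟨fun e => c e * (q ^ e.card / q ^ d.card), ?_, ?_, ?_⟩
  · intro hd
    funext e
    rw [hcδ hd]
    by_cases hed : e = d
    · subst hed
      have : q ^ e.card ≠ 0 := pow_ne_zero _ hq
      simp [this]
    · simp [hed]
  · intro e he
    have hce : c e ≠ 0 := by
      intro h0; apply he; simp only [h0, zero_mul]
    exact hcsupp e hce
  · intro t ht
    have hrw : ∀ e, c e * (q ^ e.card / q ^ d.card) * qzeta q e t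
        = (q ^ t.card / q ^ d.card) * (c e * (if e ⊆ t then (1 : ℚ) else 0)) := fun e => rescale_term_qzeta hq (c e) d e t
    simp_rw [hrw]
    rw [← Finset.mul_sum, ← hcid t ht, qzeta_eq_div_mul_zeta hq]

end FiveUpSet

end Summit.CriticalPhenomena.PercolationContinuityZ3.Theorems
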